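import Literature.NumberTheory.Automorphic.ArchInnerFormChartOrbitalSmooth   -- ★ (I₂-RegG-G′) F0P3a-p05: `contDiff_coe_gprimeBlock_apply`, the global head `contDiffOn_chartOrbG_of_uniformlyProper` (pattern); brings ★ engine `contDiffOn_integral_descConj_of_uniformlyProper`
import Literature.NumberTheory.Automorphic.ArchInnerFormChartOrbLocal        -- ★ (PROD-QUOT-G′) G2 LH3-p03: `chartOrbGLoc`, `chartOrbGLoc_def`, `chartQuotientMeasureGLoc`; brings ★ G1 `gprimeBlockAt`, `chartTorusGLoc`, `forall_mem_chartTorusGLoc_comm`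
import Literature.NumberTheory.Rogawski1990.ArchInnerFormSemiregularProper      -- ★ (J-DESC) D4b-1 F0P3a-p08: `uniformlyProper_gprimeBlock_cpt_of_injective` (ONE place, compact chart, injective angles, any subgroup)
import HarnessLib

/-!
# The ONE-PLACE chart orbital functional `chartOrbGLoc` of `U(α)_w` is `C^∞` on every open set of one-place coordinates carrying Harish-Chandra's uniform properness — in
# particular on the regular (injective-angle) set of a compact-chart place (Rogawski 1990 §8.2–8.3; Shelstad 1979 §4; Hörmander Thm. 1.1.9)

Topic `NumberTheory/Automorphic`; namespace `Literature.NumberTheory.Automorphic.UnitaryGroup`.  THEOREMS ONLY (no `def`, no instance, no notation, no axiom, no named fact, no `sorry`).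
Cell `pub/hodgecm-mathlib`, crux H413 (`stmt-HodgeConjecture-24833`), road «N8-INNER» ROAD B «EP road» (owner LH2-plan (g1), 2026-09-02T16:08Z), brick **(7)′ «REGULAR EP GENERATOR (one
place)»**, layer (i): the ONE-PLACE twin of ★ `contDiffOn_chartOrbG_of_uniformlyProper` ∕ `contDiffOn_chartOrbG_regG` (`ArchInnerFormChartOrbitalSmooth`, F0P3a-p05 (g20)) in the one-place
currency ★ `chartOrbGLoc L α w S′ ν_w` of the EP generators ((12′) census §2, LH7-p01 (g7)).  Author LH3-p04 (g7).  Count-neutral; reusable by (8) «WALL» and (10) «CORNER».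

THE MATHEMATICS.  `chartOrbGLoc L α w S′ ν_w f cw = dt′_w(B′) · ∫_{U(α)_w ⧸ T′_{S′,w}} f(y · gprimeBlockAt cw · y⁻¹) d(ν_w∕dt′_w)` (★ `chartOrbGLoc_def`).  For a one-place test function
`f = fa ∘ (↑↑·)` with `fa` smooth on `M₃(ℂ)` and `f` compactly supported, the integrand FACTORS SMOOTHLY through the `T′`-invariant continuous datum `p(y) = (Ad(↑↑y) b_k)_k`, `(b_k)` a
basis of the commutant of `↑↑T′_{S′,w}` in `M₃(ℂ)` — `f(y · γ(cw) · y⁻¹) = fa(Σ_k ℓ_k(↑↑γ(cw)) · Ad(y) b_k)` because `γ(cw) = gprimeBlockAt cw` commutes with `T′` — so the generic engine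
★ `contDiffOn_integral_descConj_of_uniformlyProper` (differentiation under the quotient integral on compacta where the orbit map is uniformly proper) applies on ANY open `U` carrying
(HYP) (`contDiffOn_chartOrbGLoc_of_uniformlyProper`); at a COMPACT-chart place (HYP) holds on the injective-angle set modulo any subgroup (★ `uniformlyProper_gprimeBlock_cpt_of_injective`),
whence **`contDiffOn_chartOrbGLoc_cpt_of_injective`** (the regular set is open, `isOpen_setOf_injective_circleExpLoc`).
HONEST LABEL: HC_CM is proved only modulo the 7 printed citations (2 remaining: hLiu418 = `stmt-HodgeConjecture-24832`, h413 = `stmt-HodgeConjecture-24833`) until rung 0 closes; measure ∕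
calculus bookkeeping, pays nothing by itself.

## References
* [Rogawski1990] J. D. Rogawski, *Automorphic Representations of Unitary Groups in Three Variables*, Ann. of Math. Stud. 123 (1990), §8.2 p. 122, §8.3 pp. 122–124.
* [Shelstad1979] D. Shelstad, *Characters and inner forms of a quasi-split group over ℝ*, Compositio Math. 39 (1979), §4 pp. 22–23.
* [Varadarajan1989] V. S. Varadarajan, *An Introduction to Harmonic Analysis on Semisimple Lie Groups* (1989), §2.4 Thm. 8 (smoothness of orbital integrals on the regular set).
* [HormanderALPDO1] L. Hörmander, *The Analysis of Linear Partial Differential Operators I* (1990), Thm. 1.1.9 (differentiation under the integral sign).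
-/

set_option autoImplicit false

noncomputable section

open MeasureTheory MeasureTheory.Measure NumberField NumberField.InfinitePlace Matrix Complex Topology
open Literature.MeasureTheory.Group Literature.NumberTheory.Rogawski1990
open scoped MatrixGroups Matrix Classical ENNReal NNReal ContDiff
open scoped Matrix.Norms.Operator

namespace Literature.NumberTheory.Automorphic.UnitaryGroup

section LocSmooth

variable (L : Type) [Field L] [NumberField L] [IsCMField L] (α : Fin 3 → L) (w : {w : InfinitePlace L // IsComplex w}) (S' : Finset {w : InfinitePlace L // IsComplex w})
  [MeasurableSpace ↥(archLocal L 3 (Matrix.diagonal α) w)] [BorelSpace ↥(archLocal L 3 (Matrix.diagonal α) w)]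
  (νw : Measure ↥(archLocal L 3 (Matrix.diagonal α) w)) [νw.IsHaarMeasure] [νw.IsMulRightInvariant]

omit [IsCMField L] [MeasurableSpace ↥(archLocal L 3 (Matrix.diagonal α) w)] [BorelSpace ↥(archLocal L 3 (Matrix.diagonal α) w)] in
/-- **The matrix of the one-place chart `gprimeBlockAt α w S′ cw` is smooth in the coordinates** (★ `contDiff_coe_gprimeBlock_apply` read at the constant family).
[cite: Rogawski1990, §3.6 p. 28; §8.2 p. 122] -/
theorem contDiff_coe_gprimeBlockAt :
    ContDiff ℝ ∞ fun cw : Fin 3 → ℝ => (((gprimeBlockAt L α w S' cw : ↥(archLocal L 3 (Matrix.diagonal α) w)) : GL (Fin 3) ℂ) : Matrix (Fin 3) (Fin 3) ℂ) := by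
  -- entrywise through the linear `Matrix.of` (the operator-norm structure on `M₃(ℂ)` is not the Pi one)
  let Λ : (Fin 3 → Fin 3 → ℂ) →L[ℝ] Matrix (Fin 3) (Fin 3) ℂ :=
    LinearMap.toContinuousLinearMap (Matrix.ofLinearEquiv ℝ : (Fin 3 → Fin 3 → ℂ) ≃ₗ[ℝ] Matrix (Fin 3) (Fin 3) ℂ).toLinearMap
  have hΛ : ∀ f : Fin 3 → Fin 3 → ℂ, Λ f = Matrix.of f := fun _ => rfl
  have hfun : (fun cw : Fin 3 → ℝ => (((gprimeBlockAt L α w S' cw : ↥(archLocal L 3 (Matrix.diagonal α) w)) : GL (Fin 3) ℂ) : Matrix (Fin 3) (Fin 3) ℂ)) =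
      fun cw => Λ fun i j => (((gprimeBlockAt L α w S' cw : ↥(archLocal L 3 (Matrix.diagonal α) w)) : GL (Fin 3) ℂ) : Matrix (Fin 3) (Fin 3) ℂ) i j := by
    funext cw; rw [hΛ]; rfl
  rw [hfun]
  refine Λ.contDiff.comp (contDiff_pi.2 fun i => contDiff_pi.2 fun j => ?_)
  have hconst : ContDiff ℝ ∞ fun cw : Fin 3 → ℝ => (fun _ : {w : InfinitePlace L // IsComplex w} => cw) :=
    contDiff_pi.2 fun _ => contDiff_id
  exact (contDiff_coe_gprimeBlock_apply L α S' w i j).comp hconst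

/-- **THE ONE-PLACE HEAD, (HYP)-BINDER FORM: `cw ↦ chartOrbGLoc L α w S′ ν_w f cw` IS `C^∞` ON EVERY OPEN SET `U` OF ONE-PLACE COORDINATES ON WHICH THE LOCAL CHART IS UNIFORMLY
PROPER MODULO `T′_{S′,w}`**, for every one-place test function `f = fa ∘ (↑↑·)` (`fa` smooth on `M₃(ℂ)`, `f` compactly supported) and every Haar `ν_w` — differentiation under the
quotient integral (★ `contDiffOn_integral_descConj_of_uniformlyProper`) with the smooth factorisation `f(y · γ(cw) · y⁻¹) = fa(Σ_k ℓ_k(↑↑γ(cw)) · Ad(↑↑y) b_k)` through a basis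
`(b_k)` of the commutant of `↑↑T′_{S′,w}` (`γ(cw) = gprimeBlockAt cw` commutes with `T′`, ★ `forall_mem_chartTorusGLoc_comm`).  The one-place twin of ★
`contDiffOn_chartOrbG_of_uniformlyProper`. [cite: Rogawski1990, §8.3 pp. 122–124] [cite: Varadarajan1989, §2.4 Thm. 8] [cite: HormanderALPDO1, Thm. 1.1.9] -/
theorem contDiffOn_chartOrbGLoc_of_uniformlyProper {U : Set (Fin 3 → ℝ)} (hU : IsOpen U)
    (hprop : ∀ K ⊆ U, IsCompact K → ∀ C : Set ↥(archLocal L 3 (Matrix.diagonal α) w), IsCompact C →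
      ∃ 𝒦 : Set (↥(archLocal L 3 (Matrix.diagonal α) w) ⧸ chartTorusGLoc L α w S'), IsCompact 𝒦 ∧
        ∀ cw ∈ K, ∀ y : ↥(archLocal L 3 (Matrix.diagonal α) w), y * gprimeBlockAt L α w S' cw * y⁻¹ ∈ C →
          (QuotientGroup.mk y : ↥(archLocal L 3 (Matrix.diagonal α) w) ⧸ chartTorusGLoc L α w S') ∈ 𝒦)
    {f : ↥(archLocal L 3 (Matrix.diagonal α) w) → ℂ} (fa : Matrix (Fin 3) (Fin 3) ℂ → ℂ) (hfa : ContDiff ℝ ∞ fa)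
    (hf : ∀ g : ↥(archLocal L 3 (Matrix.diagonal α) w), f g = fa (((g : GL (Fin 3) ℂ)) : Matrix (Fin 3) (Fin 3) ℂ)) (hfc : HasCompactSupport f) :
    ContDiffOn ℝ ∞ (chartOrbGLoc L α w S' νw f) U := by
  letI : MeasurableSpace (↥(archLocal L 3 (Matrix.diagonal α) w) ⧸ chartTorusGLoc L α w S') := borel _
  haveI : BorelSpace (↥(archLocal L 3 (Matrix.diagonal α) w) ⧸ chartTorusGLoc L α w S') := ⟨rfl⟩
  haveI := locallyCompactSpace_archLocal_three L α w
  haveI := secondCountableTopology_archLocal_three L α w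
  haveI := isHaarMeasure_chartHaarGLoc L α w S'
  haveI := isInvInvariant_chartHaarGLoc L α w S'
  haveI : IsFiniteMeasureOnCompacts (chartQuotientMeasureGLoc L α w S' νw) := by
    unfold chartQuotientMeasureGLoc
    infer_instance
  haveI : IsClosed (chartTorusGLoc L α w S' : Set ↥(archLocal L 3 (Matrix.diagonal α) w)) := isClosed_chartTorusGLoc L α w S'
  -- the ambient reading `U(α)_w → M₃(ℂ)`
  let Ebar : ↥(archLocal L 3 (Matrix.diagonal α) w) → Matrix (Fin 3) (Fin 3) ℂ := fun k => ((k : GL (Fin 3) ℂ) : Matrix (Fin 3) (Fin 3) ℂ)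
  have hEmul : ∀ x y, Ebar (x * y) = Ebar x * Ebar y := fun x y => by
    simp only [Ebar, Subgroup.coe_mul, Units.val_mul]
  have hEone : Ebar 1 = 1 := by simp only [Ebar, OneMemClass.coe_one, Units.val_one]
  have hEinv : ∀ x, Ebar x * Ebar x⁻¹ = 1 := fun x => by rw [← hEmul, mul_inv_cancel, hEone]
  have hEcont : Continuous Ebar := Units.continuous_val.comp continuous_subtype_val
  -- the commutant of `T′` in `M₃(ℂ)` and a linear projection onto it
  let A : Submodule ℝ (Matrix (Fin 3) (Fin 3) ℂ) :=
    { carrier := {m | ∀ s ∈ chartTorusGLoc L α w S', Ebar s * m = m * Ebar s}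
      add_mem' := fun {a b} ha hb s hs => by rw [mul_add, add_mul, ha s hs, hb s hs]
      zero_mem' := fun s _ => by rw [mul_zero, zero_mul]
      smul_mem' := fun r m hm s hs => by
        show Ebar s * (r • m) = r • m * Ebar s
        rw [mul_smul_comm, smul_mul_assoc, hm s hs] }
  have hAmem : ∀ m, m ∈ A ↔ ∀ s ∈ chartTorusGLoc L α w S', Ebar s * m = m * Ebar s := fun _ => Iff.rfl
  obtain ⟨B, hAB⟩ := A.exists_isCompl
  let b := Module.finBasis ℝ A
  let ℓ : Fin (Module.finrank ℝ A) → Matrix (Fin 3) (Fin 3) ℂ →ₗ[ℝ] ℝ := fun k => (b.coord k) ∘ₗ (A.projectionOnto B hAB)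
  have hℓ : ∀ k, ContDiff ℝ ∞ fun m : Matrix (Fin 3) (Fin 3) ℂ => ℓ k m := fun k => (LinearMap.toContinuousLinearMap (ℓ k)).contDiff
  have hrec : ∀ m ∈ A, ∑ k, ℓ k m • ((b k : A) : Matrix (Fin 3) (Fin 3) ℂ) = m := by
    intro m hm
    have h1 : A.projectionOnto B hAB m = ⟨m, hm⟩ := Submodule.projectionOnto_apply_of_mem_left hAB hm
    have h2 := congrArg (fun x : A => (x : Matrix (Fin 3) (Fin 3) ℂ)) (b.sum_repr (⟨m, hm⟩ : A))
    simp only [AddSubmonoidClass.coe_finsetSum, SetLike.val_smul] at h2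
    have h3 : ∀ k, ℓ k m = b.repr (⟨m, hm⟩ : A) k := fun k => by
      show b.coord k (A.projectionOnto B hAB m) = _
      rw [h1, Module.Basis.coord_apply]
    simp only [h3]
    exact h2
  -- the `T′`-invariant datum `p(y) = (Ad(y) b_k)_k`
  let p : ↥(archLocal L 3 (Matrix.diagonal α) w) → Fin (Module.finrank ℝ A) → Matrix (Fin 3) (Fin 3) ℂ :=
    fun h k => Ebar h * ((b k : A) : Matrix (Fin 3) (Fin 3) ℂ) * Ebar h⁻¹
  have hp : Continuous p := continuous_pi fun k => (hEcont.mul continuous_const).mul (hEcont.comp continuous_inv)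
  have hpM : ∀ y, ∀ m ∈ chartTorusGLoc L α w S', p (y * m) = p y := by
    intro y s hs
    funext k
    have hc : Ebar s * ((b k : A) : Matrix (Fin 3) (Fin 3) ℂ) = ((b k : A) : Matrix (Fin 3) (Fin 3) ℂ) * Ebar s := (hAmem _).1 (b k).2 s hs
    show Ebar (y * s) * ((b k : A) : Matrix (Fin 3) (Fin 3) ℂ) * Ebar (y * s)⁻¹ = Ebar y * ((b k : A) : Matrix (Fin 3) (Fin 3) ℂ) * Ebar y⁻¹
    rw [_root_.mul_inv_rev, hEmul, hEmul]
    calc Ebar y * Ebar s * ((b k : A) : Matrix (Fin 3) (Fin 3) ℂ) * (Ebar s⁻¹ * Ebar y⁻¹)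
        = Ebar y * (Ebar s * ((b k : A) : Matrix (Fin 3) (Fin 3) ℂ) * Ebar s⁻¹) * Ebar y⁻¹ := by simp only [mul_assoc]
      _ = Ebar y * ((b k : A) : Matrix (Fin 3) (Fin 3) ℂ) * Ebar y⁻¹ := by
          rw [hc, mul_assoc (((b k : A) : Matrix (Fin 3) (Fin 3) ℂ)), hEinv, mul_one]
  -- the smooth factorisation `Ψ(m, cw) = fa(∑_k ℓ_k(γ(cw)) • m_k)`
  let Ψ : (Fin (Module.finrank ℝ A) → Matrix (Fin 3) (Fin 3) ℂ) × (Fin 3 → ℝ) → ℂ :=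
    fun q => fa (∑ k, ℓ k (Ebar (gprimeBlockAt L α w S' q.2)) • q.1 k)
  have hΨ : ContDiff ℝ ∞ Ψ := by
    refine hfa.comp (ContDiff.sum fun k _ => ?_)
    have h1 : ContDiff ℝ ∞ fun q : (Fin (Module.finrank ℝ A) → Matrix (Fin 3) (Fin 3) ℂ) × (Fin 3 → ℝ) => ℓ k (Ebar (gprimeBlockAt L α w S' q.2)) :=
      (hℓ k).comp ((contDiff_coe_gprimeBlockAt L α w S').comp contDiff_snd)
    have h2 : ContDiff ℝ ∞ fun q : (Fin (Module.finrank ℝ A) → Matrix (Fin 3) (Fin 3) ℂ) × (Fin 3 → ℝ) => q.1 k :=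
      (contDiff_apply ℝ (Matrix (Fin 3) (Fin 3) ℂ) k).comp contDiff_fst
    exact h1.smul h2
  have hfac : ∀ y cw, f (y * gprimeBlockAt L α w S' cw * y⁻¹) = Ψ (p y, cw) := by
    intro y cw
    have hmem : Ebar (gprimeBlockAt L α w S' cw) ∈ A := fun s hs => by
      rw [← hEmul, ← hEmul, forall_mem_chartTorusGLoc_comm L α w S' cw s hs]
    have hsum : ∑ k, ℓ k (Ebar (gprimeBlockAt L α w S' cw)) • p y k =
        Ebar y * (∑ k, ℓ k (Ebar (gprimeBlockAt L α w S' cw)) • ((b k : A) : Matrix (Fin 3) (Fin 3) ℂ)) * Ebar y⁻¹ := by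
      rw [Finset.mul_sum, Finset.sum_mul]
      exact Finset.sum_congr rfl fun k _ => by rw [mul_smul_comm, smul_mul_assoc]
    show f _ = fa (∑ k, ℓ k (Ebar (gprimeBlockAt L α w S' cw)) • p y k)
    rw [hsum, hrec _ hmem, ← hEmul, ← hEmul]
    exact hf _
  have h := Literature.MeasureTheory.Group.contDiffOn_integral_descConj_of_uniformlyProper (chartTorusGLoc L α w S')
    (forall_mem_chartTorusGLoc_comm L α w S') hU hprop (chartQuotientMeasureGLoc L α w S' νw) hfc p hp hpM Ψ hΨ hfac
  have hEq : chartOrbGLoc L α w S' νw f = fun cw => ((chartHaarGLoc L α w S' (chartBoxImgGLoc L α w S')).toReal : ℂ) *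
      ∫ q, Literature.MeasureTheory.Group.descConj (gprimeBlockAt L α w S' cw) (chartTorusGLoc L α w S') (forall_mem_chartTorusGLoc_comm L α w S' cw) f q
        ∂(chartQuotientMeasureGLoc L α w S' νw) :=
    funext fun cw => chartOrbGLoc_def L α w S' νw f cw
  rw [hEq]
  exact contDiffOn_const.mul h

/-- **The one-place regular set of a compact-chart place — the coordinates `cw` with `e^{i cw_0}, e^{i cw_1}, e^{i cw_2}` pairwise distinct — is OPEN** (finite intersection of the
open sets `{e^{i cw_i} ≠ e^{i cw_j}}`). [cite: Rogawski1990, §3.6 p. 28] [cite: Varadarajan1989, §2.4 Thm. 8] -/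
theorem isOpen_setOf_injective_circleExpLoc : IsOpen {cw : Fin 3 → ℝ | Function.Injective fun i : Fin 3 => Circle.exp (cw i)} := by
  have e : {cw : Fin 3 → ℝ | Function.Injective fun i : Fin 3 => Circle.exp (cw i)} =
      ⋂ i : Fin 3, ⋂ j : Fin 3, {cw : Fin 3 → ℝ | i ≠ j → Circle.exp (cw i) ≠ Circle.exp (cw j)} := by
    ext cw
    simp only [Set.mem_setOf_eq, Set.mem_iInter]
    exact ⟨fun h i j hij heq => hij (h heq), fun h i j heq => by_contra fun hij => h i j hij heq⟩
  rw [e]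
  refine isOpen_iInter_of_finite fun i => isOpen_iInter_of_finite fun j => ?_
  by_cases hij : i = j
  · have : {cw : Fin 3 → ℝ | i ≠ j → Circle.exp (cw i) ≠ Circle.exp (cw j)} = Set.univ := Set.eq_univ_of_forall fun _ h => absurd hij h
    rw [this]; exact isOpen_univ
  · have : {cw : Fin 3 → ℝ | i ≠ j → Circle.exp (cw i) ≠ Circle.exp (cw j)} = {cw : Fin 3 → ℝ | Circle.exp (cw i) ≠ Circle.exp (cw j)} :=
      Set.ext fun _ => ⟨fun h => h hij, fun h _ => h⟩
    rw [this]
    exact isOpen_ne_fun (Circle.exp.continuous.comp (continuous_apply i)) (Circle.exp.continuous.comp (continuous_apply j))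

/-- **AT A COMPACT-CHART PLACE, `cw ↦ chartOrbGLoc L α w S′ ν_w f cw` IS `C^∞` ON THE ONE-PLACE REGULAR SET** `{cw | e^{i cw_i}` pairwise distinct`}` — Harish-Chandra's smoothness of
the (whole-group, ★ `chartOrbGLoc_eq_integral_of_not_mem`) orbital integral of a one-place test function at the regular points of the compact Cartan of `U(α)_w`: the head over ★
`uniformlyProper_gprimeBlock_cpt_of_injective`. [cite: Rogawski1990, §8.3 pp. 122–124] [cite: Shelstad1979, §4 pp. 22–23] [cite: Varadarajan1989, §2.4 Thm. 8] -/
theorem contDiffOn_chartOrbGLoc_cpt_of_injective (hα : ∀ i, α i ≠ 0) (hw : ¬ (w ∈ S' ∧ w ∈ splitChartPlaces L α))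
    {f : ↥(archLocal L 3 (Matrix.diagonal α) w) → ℂ} (fa : Matrix (Fin 3) (Fin 3) ℂ → ℂ) (hfa : ContDiff ℝ ∞ fa)
    (hf : ∀ g : ↥(archLocal L 3 (Matrix.diagonal α) w), f g = fa (((g : GL (Fin 3) ℂ)) : Matrix (Fin 3) (Fin 3) ℂ)) (hfc : HasCompactSupport f) :
    ContDiffOn ℝ ∞ (chartOrbGLoc L α w S' νw f) {cw : Fin 3 → ℝ | Function.Injective fun i : Fin 3 => Circle.exp (cw i)} :=
  contDiffOn_chartOrbGLoc_of_uniformlyProper L α w S' νw isOpen_setOf_injective_circleExpLoc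
    (fun K hK hKc C hC => uniformlyProper_gprimeBlock_cpt_of_injective L α S' hα hw (chartTorusGLoc L α w S') K hK hKc C hC) fa hfa hf hfc

end LocSmooth

end Literature.NumberTheory.Automorphic.UnitaryGroup

end
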